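import Summits.CriticalPhenomena.CardyFormulaZ2.Theses.CardySelfDualSegment
import Summits.CriticalPhenomena.CardyFormulaZ2.Theorems.CardySelfDualSegmentUniformBoxCrossingStubGlue
import Summits.CriticalPhenomena.CardyFormulaZ2.Theorems.CardySelfDualSegmentUniformBoxCrossingStubUpper
import Summits.CriticalPhenomena.CardyFormulaZ2.Theorems.CardySelfDualSegmentUniformBoxCrossingStubRender
import Summits.CriticalPhenomena.CardyFormulaZ2.Theorems.CardySelfDualSegmentUniformBoxCrossingStubJoin
import Summits.CriticalPhenomena.CardyFormulaZ2.Theorems.CardySelfDualSegmentUniformBoxCrossingStubBRChainPart1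
import Summits.CriticalPhenomena.CardyFormulaZ2.Theorems.CardySelfDualSegmentUniformBoxCrossingStubExplore
import Summits.CriticalPhenomena.CardyFormulaZ2.Theorems.CardySelfDualSegmentUniformBoxCrossingStubCover
import Summits.CriticalPhenomena.CardyFormulaZ2.Theorems.CardySelfDualSegmentUniformBoxCrossingStubSmallGap
import Summits.CriticalPhenomena.CardyFormulaZ2.Theorems.CardySelfDualSegmentUniformBoxCrossingStubJunction
import Summits.CriticalPhenomena.CardyFormulaZ2.Theorems.CardySelfDualSegmentUniformBoxCrossingStubLink
import Summits.CriticalPhenomena.CardyFormulaZ2.Theorems.CardySelfDualSegmentUniformBoxCrossingStubAssembly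
import HarnessLib

/-!
# The Bollobás–Riordan engine of line `Sketch`, assembled (crux stmt-CriticalPhenomena-5476 `UniformBoxCrossing`)

With all six engine stubs of the reshaped skeleton landed (`stub_explore`, `stub_cover`,
`stub_smallGap`, `stub_junction`, `stub_link`, `stub_assembly`) and the earlier chain
(`stub_brChain_of_tbBound`, `stub_join`, `stub_glue`, `stub_upper`, `stub_render`), the crux
`Summit.CriticalPhenomena.CardyFormulaZ2.Theses.CardySelfDualSegment.UniformBoxCrossing` follows
from the one remaining kernel statement `NonSlantStatement` (the t-uniform Non-Slant lemma of
Bollobás–Riordan 2010, Lemma 5.2, for the corner models `M_t = cornerPercolation t`). This file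
records that implication as a sorry-free theorem, `uniformBoxCrossing_of_nonSlant`: the crux is
reduced, in Lean, to a single-square, single-scale, directly simulable statement. (The kernel
itself is research-level; `…NonSlantOfComparable.lean` reduces it further to t-uniform diagonal
comparability of the two slanted crossing probabilities.)
-/

namespace Summit.CriticalPhenomena.CardyFormulaZ2.Cruxes.UniformBoxCrossing.NonSlantLine

open MeasureTheory Literature.Probability.Percolation Literature.Probability.LatticeModels
open Summit.CriticalPhenomena.CardyFormulaZ2.Theses.CardySelfDualSegment

/-- **The engine**: the t-uniform Non-Slant lemma implies the crux `UniformBoxCrossing`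
(Bollobás–Riordan 2010 §5.1 transplanted to the corner product measure: Non-Slant ⇒ (Lemma 5.6,
proof of Thm 5.3: explorations, `f_ALG`, chaining, junction recolouring) uniform hard-way
`TB([0,n]×[0,n+k])` ⇒ JOIN ⇒ hard-way `2:1` ⇒ every aspect ratio ⇒ two-sided ⇒ the `√2 ℤ²`
rendering of `BoxCrossingBounds`, all constants uniform in `t ∈ [0,1]`).
[cite: BollobasRiordan2010, §5.1 Thm. 5.3] -/
theorem uniformBoxCrossing_of_nonSlant (hNS : NonSlantStatement) : UniformBoxCrossing := by
  have hTB : TBStatement :=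
    stub_assembly hNS stub_explore (stub_smallGap (stub_cover stub_explore.1) stub_explore)
      stub_junction stub_link
  have hLB := stub_glue (stub_join (stub_brChain_of_tbBound hTB))
  have hbox := stub_render hLB (stub_upper hLB)
  show ∀ ρ : ℝ, 0 < ρ → ∃ c > 0, ∃ n₀ : ℕ, ∀ t : unitInterval,
    BoxCrossingBounds ((prodBernoulli (cornerParam t)).map cornerConfig) squareLatticeEmbedding.z ρ c n₀
  exact hbox

/-- Statement form of the engine — a registered step the LINE POSITS and proves right below
(`engine_holds`); not a literature fact, never to be relocated. -/
def EngineStatement : Prop := NonSlantStatement → UniformBoxCrossing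

/-- The engine, statement form. [cite: BollobasRiordan2010, §5.1 Thm. 5.3] -/
theorem engine_holds : EngineStatement := uniformBoxCrossing_of_nonSlant

end Summit.CriticalPhenomena.CardyFormulaZ2.Cruxes.UniformBoxCrossing.NonSlantLine
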